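import Summits.HubbardSuperconductivity.HubbardSuperconductivity.Theses.RelocationFloor
import HarnessLib

/-!
# Birth skeleton (BC3) for the crux `BlochPairSiteDensity` (stmt-HubbardSuperconductivity-18071; piece X₃ of the split of `B1gSignCoherence`, route `RelocationFloor`)

Line "one point × translation invariance": for a Bloch vector every `⟨ψ, O_x ψ⟩` with a
translation-covariant family `O_x` is independent of `x` (`expect_relabel_translate_of_bloch` of
`FunctionFieldCertificateMesoscopicPairOrderBloch`), so `Σ_x ‖A_{x,e}ᴴ A_{x+r,e'} ψ‖² = L² ‖A_{0,e}ᴴ A_{r,e'} ψ‖²`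
(`stub_blochOnePoint`, provable now); the content is the ONE-POINT pair-site density floor at the origin
bond for Bloch ground states (`stub_originPairSiteDensity`, implied by the route's `PairSiteDensity` at
`x = 0, y = r`); `BlochPairSiteDensity_of` composes them.
-/

noncomputable section

set_option linter.dupNamespace false

namespace Summit.HubbardSuperconductivity.HubbardSuperconductivity.Cruxes.BlochPairSiteDensity.Birth

open Matrix Finset
open Literature.Probability.LatticeModels Literature.MathematicalPhysics.QuantumLattice
open Summit.HubbardSuperconductivity.HubbardSuperconductivity.Theses.RelocationFloor

/-- STUB A (Bloch one-point reduction, provable now): in a Bloch vector the translation-summed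
transplant mass is `L²` times its value at the origin bond. [difficulty: provable-now] -/
theorem stub_blochOnePoint : ∀ (L : ℕ) [NeZero L] (ψ : Fock (Orb (FermionTorus 2 L))), (∀ v : TorusSite 2 L, ∃ c : ℂ, (fockTranslate v).val *ᵥ ψ = c • ψ) → ∀ (r : TorusSite 2 L) (e e' : Site 2), let A : TorusSite 2 L → Site 2 → Matrix (Finset (Orb (FermionTorus 2 L))) (Finset (Orb (FermionTorus 2 L))) ℂ := fun x u => annihilation (orb (FermionTorus.ofTorusSite x) 0) * annihilation (orb (FermionTorus.ofTorusSite (x + Torus.proj L u)) 1); let φ : TorusSite 2 L → Fock (Orb (FermionTorus 2 L)) := fun x => ((A x e)ᴴ * A (x + r) e') *ᵥ ψ; ∑ x : TorusSite 2 L, (star (φ x) ⬝ᵥ φ x).re = (L : ℝ) ^ 2 * (star (φ 0) ⬝ᵥ φ 0).re := by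
  sorry

/-- STUB B (origin pair-site density): the transplant mass at the origin bond of every Bloch ground
state in the box is bounded below at far displacement (the route's `PairSiteDensity` at `x = 0`,
`y = r`, restricted to Bloch states). [difficulty: L] -/
theorem stub_originPairSiteDensity : ∀ U ∈ Set.Icc (2 : ℝ) 5, ∀ δ ∈ Set.Icc (1 / 5 : ℝ) (3 / 10), ∃ p₀ : ℝ, 0 < p₀ ∧ ∃ R L₀ : ℕ, ∀ (L : ℕ) [NeZero L], L₀ ≤ L → Even L → ∀ ψ : Fock (Orb (FermionTorus 2 L)), star ψ ⬝ᵥ ψ = 1 → IsGroundStateInSector (hubbardTorus 2 L 1 U) (2 * ⌊(1 - δ) * (L : ℝ) ^ 2 / 2⌋₊) 0 ψ → (∀ v : TorusSite 2 L, ∃ c : ℂ, (fockTranslate v).val *ᵥ ψ = c • ψ) → ∀ r : TorusSite 2 L, R ≤ torusDist r 0 → ∀ e ∈ unitSteps, ∀ e' ∈ unitSteps, let A : TorusSite 2 L → Site 2 → Matrix (Finset (Orb (FermionTorus 2 L))) (Finset (Orb (FermionTorus 2 L))) ℂ := fun x u => annihilation (orb (FermionTorus.ofTorusSite x) 0) *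 annihilation (orb (FermionTorus.ofTorusSite (x + Torus.proj L u)) 1); let φ : TorusSite 2 L → Fock (Orb (FermionTorus 2 L)) := fun x => ((A x e)ᴴ * A (x + r) e') *ᵥ ψ; p₀ ≤ (star (φ 0) ⬝ᵥ φ 0).re := by
  sorry

/-- Composition: `p₀ L² ≤ L² ‖φ_0‖² = Σ_x ‖φ_x‖²`, i.e. `BlochPairSiteDensity` (by name). [folklore] -/
theorem BlochPairSiteDensity_of : (∀ (L : ℕ) [NeZero L] (ψ : Fock (Orb (FermionTorus 2 L))), (∀ v : TorusSite 2 L, ∃ c : ℂ, (fockTranslate v).val *ᵥ ψ = c • ψ) → ∀ (r : TorusSite 2 L) (e e' : Site 2), let A : TorusSite 2 L → Site 2 → Matrix (Finset (Orb (FermionTorus 2 L))) (Finset (Orb (FermionTorus 2 L))) ℂ := fun x u => annihilation (orb (FermionTorus.ofTorusSite x) 0) * annihilation (orb (FermionTorus.ofTorusSite (x + Torus.proj L u)) 1); let φ : TorusSite 2 L → Fock (Orb (FermionTorus 2 L)) := fun x => ((A x e)ᴴ * A (x + r) e') *ᵥ ψ; ∑ x : TorusSite 2 L, (star (φ x) ⬝ᵥ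 φ x).re = (L : ℝ) ^ 2 * (star (φ 0) ⬝ᵥ φ 0).re) → (∀ U ∈ Set.Icc (2 : ℝ) 5, ∀ δ ∈ Set.Icc (1 / 5 : ℝ) (3 / 10), ∃ p₀ : ℝ, 0 < p₀ ∧ ∃ R L₀ : ℕ, ∀ (L : ℕ) [NeZero L], L₀ ≤ L → Even L → ∀ ψ : Fock (Orb (FermionTorus 2 L)), star ψ ⬝ᵥ ψ = 1 → IsGroundStateInSector (hubbardTorus 2 L 1 U) (2 * ⌊(1 - δ) * (L : ℝ) ^ 2 / 2⌋₊) 0 ψ → (∀ v : TorusSite 2 L, ∃ c : ℂ, (fockTranslate v).val *ᵥ ψ = c • ψ) → ∀ r : TorusSite 2 L, R ≤ torusDist r 0 → ∀ e ∈ unitSteps, ∀ e' ∈ unitSteps, let A : TorusSite 2 L → Site 2 → Matrix (Finset (Orb (FermionTorus 2 L))) (Finset (Orb (FermionTorus 2 L))) ℂ := fun x u => annihilation (orb (FermionTorus.ofTorusSite x) 0) * annihilation (orb (FermionTorus.ofTorusSite (x + Torus.proj L u)) 1); let φ : TorusSite 2 L → Fock (Orb (FermionTorus 2 L)) := fun x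 => ((A x e)ᴴ * A (x + r) e') *ᵥ ψ; p₀ ≤ (star (φ 0) ⬝ᵥ φ 0).re) → (∀ U ∈ Set.Icc (2 : ℝ) 5, ∀ δ ∈ Set.Icc (1 / 5 : ℝ) (3 / 10), ∃ p₀ : ℝ, 0 < p₀ ∧ ∃ R L₀ : ℕ, ∀ (L : ℕ) [NeZero L], L₀ ≤ L → Even L → ∀ ψ : Fock (Orb (FermionTorus 2 L)), star ψ ⬝ᵥ ψ = 1 → IsGroundStateInSector (hubbardTorus 2 L 1 U) (2 * ⌊(1 - δ) * (L : ℝ) ^ 2 / 2⌋₊) 0 ψ → (∀ v : TorusSite 2 L, ∃ c : ℂ, (fockTranslate v).val *ᵥ ψ = c • ψ) → ∀ r : TorusSite 2 L, R ≤ torusDist r 0 → ∀ e ∈ unitSteps, ∀ e' ∈ unitSteps, let A : TorusSite 2 L → Site 2 → Matrix (Finset (Orb (FermionTorus 2 L))) (Finset (Orb (FermionTorus 2 L))) ℂ := fun x u => annihilation (orb (FermionTorus.ofTorusSite x) 0) * annihilation (orb (FermionTorus.ofTorusSite (x + Torus.proj L u)) 1); let φ : TorusSite 2 L → Fock (Orb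 (FermionTorus 2 L)) := fun x => ((A x e)ᴴ * A (x + r) e') *ᵥ ψ; p₀ * (L : ℝ) ^ 2 ≤ ∑ x : TorusSite 2 L, (star (φ x) ⬝ᵥ φ x).re) := by
  intro hO hP U hU δ hδ
  obtain ⟨p₀, hp₀, R, L₀, hP⟩ := hP U hU δ hδ
  refine ⟨p₀, hp₀, R, L₀, ?_⟩
  intro L _ hL hE ψ hψ hgs hb r hr e he e' he'
  set A : TorusSite 2 L → Site 2 → Matrix (Finset (Orb (FermionTorus 2 L))) (Finset (Orb (FermionTorus 2 L))) ℂ :=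
    fun x u => annihilation (orb (FermionTorus.ofTorusSite x) 0) *
      annihilation (orb (FermionTorus.ofTorusSite (x + Torus.proj L u)) 1) with hAdef
  set T : TorusSite 2 L → Matrix (Finset (Orb (FermionTorus 2 L))) (Finset (Orb (FermionTorus 2 L))) ℂ :=
    fun x => (A x e)ᴴ * A (x + r) e' with hTdef
  have hO' : ∑ x : TorusSite 2 L, (star (T x *ᵥ ψ) ⬝ᵥ (T x *ᵥ ψ)).re = (L : ℝ) ^ 2 * (star (T 0 *ᵥ ψ) ⬝ᵥ (T 0 *ᵥ ψ)).re :=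
    hO L ψ hb r e e'
  have hP' : p₀ ≤ (star (T 0 *ᵥ ψ) ⬝ᵥ (T 0 *ᵥ ψ)).re := hP L hL hE ψ hψ hgs hb r hr e he e' he'
  show p₀ * (L : ℝ) ^ 2 ≤ ∑ x : TorusSite 2 L, (star (T x *ᵥ ψ) ⬝ᵥ (T x *ᵥ ψ)).re
  rw [hO']
  nlinarith [sq_nonneg (L : ℝ)]

/-- **The crux BY NAME from the two named stubs** (hypothesis-free form; its only `sorry`s are the
stubs'; this is the theorem `#h21_check_skeleton` registers — `BlochPairSiteDensity_of` below it has the BC3 shape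
`stub-statements → crux-statement` with the crux statement spelled out, so that it is not a by-name candidate). [folklore] -/
theorem BlochPairSiteDensity_of_stubs : BlochPairSiteDensity :=
  BlochPairSiteDensity_of stub_blochOnePoint stub_originPairSiteDensity

end Summit.HubbardSuperconductivity.HubbardSuperconductivity.Cruxes.BlochPairSiteDensity.Birth
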